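import Literature.Topology.FourManifolds.AndrewsCurtisCertificate

/-!
# Normal-closure certificates: an executable checker that a finite presentation presents the trivial group

A *normal-closure certificate* for a word presentation `P = ⟨x₀,…,xₙ₋₁ ∣ r₀,…,rₙ₋₁⟩` (`ACCert.WPres n`)
is a straight-line program whose lines are words provably in the normal closure
`N = ⟨⟨r₀,…,rₙ₋₁⟩⟩ ≤ FreeGroup (Fin n)`: each line is a relator or its inverse, the inverse of an
earlier line, the product of two earlier lines, or a conjugate `g · w · g⁻¹` of an earlier line `w`
by a word `g` taken from a second table of conjugating words that the program builds letter by
letter.  If for every generator the one-letter word `xᵢ` occurs as a line, then `N` contains every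
generator, `N = ⊤`, and the presented group is trivial (`BalancedPresentation.PresentsTrivialGroup`).

Such certificates are exactly the "proof words" that a coset enumeration over the trivial subgroup
can be made to emit when it collapses to index `1` (Havas–Ramsay, *Proving a group trivial made
easy* — the PEACE utility; *Andrews–Curtis and Todd–Coxeter proof words*): every coset-table entry
and every coincidence is justified by a word of `N`, and the justifications compose.  This file is
the Lean counterpart of the certificate REPLAYER only: an enumeration program emits the program, the
kernel re-executes it, and the soundness theorems turn the replay into a theorem.  Nothing in this
file enumerates cosets.

## Sources

* G. Havas, C. Ramsay, *Proving a group trivial made easy: a case study in coset enumeration*,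
  Bull. Austral. Math. Soc. 62 (2000) 105–118, doi:10.1017/s0004972700018529. [HavasRamsay2000]
* G. Havas, C. Ramsay, *Andrews–Curtis and Todd–Coxeter proof words*, in: Groups St Andrews 2001 in
  Oxford, Vol. I, LMS Lecture Note Ser. 304, CUP (2003) 232–237, doi:10.1017/cbo9780511542770.022.
  [HavasRamsay2003]
* J. A. Todd, H. S. M. Coxeter, *A practical method for enumerating cosets of a finite abstract
  group*, Proc. Edinburgh Math. Soc. 5 (1936) 26–34. [ToddCoxeter1936]

## Format and design (kernel cost)

A certificate is cut into BLOCKS of at most `64` steps.  A block is one natural number packing its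
steps in `40`-bit fields (`op + a·2⁴ + b·2²²`, `a, b < 2¹⁸`; `op ∈ {1 rep, 2 rel, 3 inv, 4 mul, 5 conj}`,
`0` ends the block; decoded with `Nat.land` / `Nat.shiftRight`, which the kernel evaluates by GMP
arithmetic), run by `NCCert.blk R Lin Win prog : List word × List word` = (the proof lines, the
conjugating words) the block produces, newest first.  `Lin` / `Win` are the line / word OUTPUTS OF EARLIER BLOCKS that this block
reads, listed explicitly by the certificate (`[B₃.val.1, B₀.val.1, …]`); an operand `x` addresses
`local[x/2]` (even `x`: the block's own output so far, newest first) or entry `x / 2⁹` of input list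
`(x/2) % 2⁸` (odd `x`).
Semantics: `rep a b` — new word := (word `a`) · (letter of code `b`: `2g ↦ x_g`, `2g+1 ↦ x_g⁻¹`);
`rel a b` — new line := relator `a` (`b = 0`) or its inverse; `inv a` — (line `a`)⁻¹; `mul a b` —
line `a` · line `b`; `conj a b` — (word `a`) · (line `b`) · (word `a`)⁻¹.  A missing operand reads as
the empty word, so EVERY block is sound: `NCCert.blk_sound` — if the input lines lie in `N`, so do the
output lines (the words are unconstrained).  A certificate for a census row is then a sequence of
definitions `Bₖ : SBlock P := mkBlock (relTable P) (allN_relTable P) [Bᵢ.val.1, …] ⟨Bᵢ.sound, …⟩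
[Bⱼ.val.2, …] 0x…`
(`NCCert.SBlock` = block output + membership proof, so no per-block theorem is elaborated), and a
final `decide` that the named goal lines are the one-letter words `xᵢ`
(`NCCert.presentsTrivialGroup_of_certify`).  Making each
block a DEFINITION is what keeps kernel replay cheap: the kernel caches the value of a constant, so
a line is computed once however often it is read, and reads are short list walks.  Words are kept
freely reduced by `NCCert.mulRed`, which cancels at the junction of two reduced words (soundness
`NCCert.mk_mulRed`: one `FreeGroup.Red.Step.not` per cancelled pair); relators are reduced once
(`FreeGroup.reduce`); every produced word is forced (a `match` on its length) so that no long chain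
of suspended computations builds up.  All per-letter list functions are raw `List.rec` terms (one
iota step per letter; structurally recursive definitions cost the kernel ~10× more per step).  Soundness uses `FreeGroup.reduce.self`, `FreeGroup.mul_mk`,
`FreeGroup.inv_mk` and the closure properties of `Subgroup.normalClosure` only.
-/

namespace Literature.Topology.FourManifolds

namespace NCCert

variable {n : ℕ}

/-- Words in `n` generators (`FreeGroup.mk` encoding). [folklore] -/
abbrev W (n : ℕ) : Type := List (Fin n × Bool)

/-! ### Words: raw-recursor list primitives

Every function the kernel iterates per letter is written with the raw recursor `List.rec` and an
explicit motive (one iota step per letter), not by structural recursion (whose `brecOn`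
compilation costs the kernel an order of magnitude more per step); each comes with the lemma
identifying it with the library function. -/

/-- `revApp u acc = u.reverse ++ acc` (raw recursor). [folklore] -/
def revApp (u acc : W n) : W n :=
  List.rec (motive := fun _ ↦ W n → W n) (fun acc ↦ acc) (fun a _ r acc ↦ r (a :: acc)) u acc

/-- The raw-recursor reverse-append is `List.reverseAux`. [folklore] -/
theorem revApp_eq : ∀ (u acc : W n), revApp u acc = List.reverseAux u acc
  | [], _ => rfl
  | _ :: u, _ => revApp_eq u _

/-- `a` and `b` are mutually inverse letters (raw: `Nat.beq` on the generator indices). [folklore] -/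
def cancel1 (a b : Fin n × Bool) : Bool :=
  (Nat.beq a.1.val b.1.val) && (match a.2, b.2 with
    | true, false => true
    | false, true => true
    | _, _ => false)

/-- `cancel1` decides that two letters are mutually inverse. [folklore] -/
theorem cancel1_iff (a b : Fin n × Bool) : cancel1 a b = true ↔ a.1 = b.1 ∧ a.2 = !b.2 := by
  obtain ⟨a1, a2⟩ := a
  obtain ⟨b1, b2⟩ := b
  unfold cancel1
  rw [Bool.and_eq_true_iff, Nat.beq_eq, Fin.val_inj]
  cases a2 <;> cases b2 <;> simp

/-- Junction cancellation: `cancelAux ru v` with `ru` a word read backwards returns `ru.reverse ++ v`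
with the cancelling pairs at the junction removed (all of them if both words are freely reduced).
[folklore] -/
def cancelAux (ru v : W n) : W n :=
  List.rec (motive := fun _ ↦ W n → W n) (fun v ↦ v)
    (fun a as r v ↦ List.casesOn (motive := fun _ ↦ W n) v (revApp as [a])
      (fun b bs ↦ bif cancel1 a b then r bs else revApp as (a :: b :: bs))) ru v

/-- Product of two words with free cancellation at the junction only. [folklore] -/
def mulRed (u v : W n) : W n := cancelAux (revApp u []) v

/-- Junction cancellation does not change the element of the free group (one
`FreeGroup.Red.Step.not` per cancelled pair). [folklore] -/
theorem mk_cancelAux : ∀ (ru v : W n),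
    FreeGroup.mk (cancelAux ru v) = FreeGroup.mk (List.reverseAux ru v)
  | [], _ => rfl
  | a :: as, [] => by
      show FreeGroup.mk (revApp as [a]) = _
      rw [revApp_eq]; rfl
  | a :: as, b :: bs => by
      show FreeGroup.mk (bif cancel1 a b then cancelAux as bs else revApp as (a :: b :: bs)) = _
      cases hc : cancel1 a b
      · simp only [cond_false]; rw [revApp_eq]; rfl
      · simp only [cond_true]
        rw [mk_cancelAux as bs]
        obtain ⟨h1, h2⟩ := (cancel1_iff a b).1 hc
        obtain ⟨a1, a2⟩ := a
        obtain ⟨b1, b2⟩ := b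
        simp only at h1 h2
        subst h1; subst h2
        show FreeGroup.mk (List.reverseAux as bs) =
          FreeGroup.mk (List.reverseAux as ((a1, !b2) :: (a1, b2) :: bs))
        rw [List.reverseAux_eq, List.reverseAux_eq]
        have step := @FreeGroup.Red.Step.not _ as.reverse bs a1 (!b2)
        rw [Bool.not_not] at step
        exact (Quot.sound step).symm

/-- `mulRed` is multiplication in the free group. [folklore] -/
theorem mk_mulRed (u v : W n) :
    FreeGroup.mk (mulRed u v) = FreeGroup.mk u * FreeGroup.mk v := by
  rw [mulRed, mk_cancelAux, revApp_eq, List.reverseAux_eq, List.reverseAux_eq, List.append_nil,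
    List.reverse_reverse, FreeGroup.mul_mk]

/-- Formal inverse of a word (raw recursor; `= FreeGroup.invRev`). [folklore] -/
def invW (u : W n) : W n :=
  List.rec (motive := fun _ ↦ W n → W n) (fun acc ↦ acc) (fun a _ r acc ↦ r ((a.1, !a.2) :: acc)) u []

/-- The accumulator form of `invW` computes `FreeGroup.invRev` followed by the accumulator.
[folklore] -/
theorem invW_aux : ∀ (u acc : W n),
    List.rec (motive := fun _ ↦ W n → W n) (fun acc ↦ acc) (fun a _ r acc ↦ r ((a.1, !a.2) :: acc)) u
      acc = FreeGroup.invRev u ++ acc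
  | [], _ => by simp [FreeGroup.invRev]
  | a :: u, acc => by
      show List.rec (motive := fun _ ↦ W n → W n) (fun acc ↦ acc)
        (fun a _ r acc ↦ r ((a.1, !a.2) :: acc)) u ((a.1, !a.2) :: acc) = _
      rw [invW_aux u]
      simp [FreeGroup.invRev]

/-- `invW` is inversion in the free group (`FreeGroup.inv_mk`). [folklore] -/
theorem mk_invW (u : W n) : FreeGroup.mk (invW u) = (FreeGroup.mk u)⁻¹ := by
  rw [FreeGroup.inv_mk]
  show FreeGroup.mk (List.rec (motive := fun _ ↦ W n → W n) (fun acc ↦ acc)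
    (fun a _ r acc ↦ r ((a.1, !a.2) :: acc)) u []) = _
  rw [invW_aux, List.append_nil]

/-- Length of a word (raw recursor; `Nat.add` forces full evaluation). [folklore] -/
def wlen (u : W n) : ℕ := List.rec (motive := fun _ ↦ ℕ) 0 (fun _ _ r ↦ Nat.add r 1) u

/-- `nth l i = l.getD i []` (raw recursors on the list and on the index literal). [folklore] -/
def nth (l : List (W n)) (i : ℕ) : W n :=
  List.rec (motive := fun _ ↦ ℕ → W n) (fun _ ↦ [])
    (fun a _ r i ↦ Nat.rec (motive := fun _ ↦ W n) a (fun j _ ↦ r j) i) l i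

/-- `nth` agrees with `List.getD` (default: the empty word). [folklore] -/
theorem nth_eq : ∀ (l : List (W n)) (i : ℕ), nth l i = l.getD i []
  | [], i => by rw [List.getD_nil]; rfl
  | a :: l, 0 => by rw [List.getD_cons_zero]; rfl
  | a :: l, i + 1 => by rw [List.getD_cons_succ, ← nth_eq l i]; rfl

/-- `nthL ls k = ls.getD k []` for a list of lists (raw recursors). [folklore] -/
def nthL (ls : List (List (W n))) (k : ℕ) : List (W n) :=
  List.rec (motive := fun _ ↦ ℕ → List (W n)) (fun _ ↦ [])
    (fun l _ r k ↦ Nat.rec (motive := fun _ ↦ List (W n)) l (fun j _ ↦ r j) k) ls k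

/-- `nthL` agrees with `List.getD` (default: the empty list). [folklore] -/
theorem nthL_eq : ∀ (ls : List (List (W n))) (k : ℕ), nthL ls k = ls.getD k []
  | [], k => by rw [List.getD_nil]; rfl
  | l :: ls, 0 => by rw [List.getD_cons_zero]; rfl
  | l :: ls, k + 1 => by rw [List.getD_cons_succ, ← nthL_eq ls k]; rfl

/-! ### Membership bookkeeping -/

/-- The normal closure of the relators of a word presentation. [folklore] -/
def N (P : ACCert.WPres n) : Subgroup (FreeGroup (Fin n)) :=
  Subgroup.normalClosure (Set.range (ACCert.toPres P))

/-- Every word of the list lies in `N P` (a recursive conjunction, so that a proof for an explicit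
list is an anonymous-constructor tuple). [folklore] -/
def AllN (P : ACCert.WPres n) : List (W n) → Prop
  | [] => True
  | w :: l => FreeGroup.mk w ∈ N P ∧ AllN P l

/-- Any entry of a list of words in `N P` lies in `N P` (the default `[]` does: `one_mem`).
[folklore] -/
theorem AllN.getD {P : ACCert.WPres n} :
    ∀ {l : List (W n)} (_ : AllN P l) (i : ℕ), FreeGroup.mk (l.getD i []) ∈ N P
  | [], _, i => by rw [List.getD_nil]; exact (N P).one_mem
  | w :: _, ⟨hw, _⟩, 0 => by rw [List.getD_cons_zero]; exact hw
  | _ :: _, ⟨_, hl⟩, i + 1 => by rw [List.getD_cons_succ]; exact AllN.getD hl i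

/-- `AllN.getD` for the raw accessor `nth`. [folklore] -/
theorem AllN.nth {P : ACCert.WPres n} {l : List (W n)} (h : AllN P l) (i : ℕ) :
    FreeGroup.mk (nth l i) ∈ N P := by
  rw [nth_eq]; exact h.getD i

/-- From a pointwise membership statement to the recursive conjunction `AllN`. [folklore] -/
theorem AllN.of_forall {P : ACCert.WPres n} :
    ∀ {l : List (W n)}, (∀ w ∈ l, FreeGroup.mk w ∈ N P) → AllN P l
  | [], _ => trivial
  | w :: l, h => ⟨h w (by simp), AllN.of_forall fun v hv ↦ h v (by simp [hv])⟩

/-- Extending an `AllN` list by one word of `N P`. [folklore] -/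
theorem AllN.cons {P : ACCert.WPres n} {w : W n} {l : List (W n)} (hw : FreeGroup.mk w ∈ N P)
    (hl : AllN P l) : AllN P (w :: l) := ⟨hw, hl⟩

/-- Every list of the list satisfies `AllN P` (recursive conjunction). [folklore] -/
def AllN2 (P : ACCert.WPres n) : List (List (W n)) → Prop
  | [] => True
  | l :: ls => AllN P l ∧ AllN2 P ls

/-- Any entry of an `AllN2` list of lists satisfies `AllN` (the default `[]` does trivially).
[folklore] -/
theorem AllN2.getD {P : ACCert.WPres n} :
    ∀ {ls : List (List (W n))} (_ : AllN2 P ls) (k : ℕ), AllN P (ls.getD k [])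
  | [], _, k => by rw [List.getD_nil]; trivial
  | _ :: _, ⟨hl, _⟩, 0 => by rw [List.getD_cons_zero]; exact hl
  | _ :: _, ⟨_, hls⟩, k + 1 => by rw [List.getD_cons_succ]; exact AllN2.getD hls k

/-- `AllN2.getD` for the raw accessor `nthL`. [folklore] -/
theorem AllN2.nthL {P : ACCert.WPres n} {ls : List (List (W n))} (h : AllN2 P ls) (k : ℕ) :
    AllN P (nthL ls k) := by
  rw [nthL_eq]; exact h.getD k

/-- The relator table, freely reduced once. [folklore] -/
def relTable (P : ACCert.WPres n) : List (W n) := (List.finRange n).map fun i ↦ FreeGroup.reduce (P i)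

/-- The reduced relators lie in the normal closure of the relators (`FreeGroup.reduce.self`,
`Subgroup.subset_normalClosure`). [folklore] -/
theorem allN_relTable (P : ACCert.WPres n) : AllN P (relTable P) := by
  refine AllN.of_forall fun w hw ↦ ?_
  obtain ⟨i, -, rfl⟩ := List.mem_map.1 hw
  rw [FreeGroup.reduce.self]
  exact Subgroup.subset_normalClosure ⟨i, rfl⟩

/-! ### The block machine -/

/-- Operand fetch: even `x` reads entry `x / 2` of the block's own output (newest first); odd `x`
reads entry `x / 2⁹` of input list number `(x / 2) % 2⁸` (the output of an earlier block); a
missing entry reads as the empty word. [folklore] -/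
def sel (loc : List (W n)) (inp : List (List (W n))) (x : ℕ) : W n :=
  bif Nat.beq (Nat.land x 1) 0 then nth loc (Nat.shiftRight x 1)
  else nth (nthL inp (Nat.land (Nat.shiftRight x 1) 255)) (Nat.shiftRight x 9)

/-- Every operand fetch returns a word of `N P` when the local lines and all input lists lie in `N
P`. [folklore] -/
theorem sel_mem {P : ACCert.WPres n} {loc : List (W n)} {inp : List (List (W n))} (hl : AllN P loc)
    (hi : AllN2 P inp) (x : ℕ) : FreeGroup.mk (sel loc inp x) ∈ N P := by
  unfold sel
  cases Nat.beq (Nat.land x 1) 0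
  · exact (hi.nthL _).nth _
  · exact hl.nth _

/-- Block state: the proof lines and the conjugating words produced so far, newest first. [folklore] -/
structure BState (n : ℕ) : Type where
  lines : List (W n)
  reps : List (W n)

/-- Push a proof line, forcing its evaluation (the `match` on the length). [folklore] -/
def BState.pushL (st : BState n) (w : W n) : BState n :=
  match wlen w with
  | 0 => ⟨w :: st.lines, st.reps⟩
  | _ + 1 => ⟨w :: st.lines, st.reps⟩

/-- Push a conjugating word, forcing its evaluation. [folklore] -/
def BState.pushR (st : BState n) (w : W n) : BState n :=
  match wlen w with
  | 0 => ⟨st.lines, w :: st.reps⟩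
  | _ + 1 => ⟨st.lines, w :: st.reps⟩

/-- `pushL` is `cons` on the lines (the `match` only forces evaluation). [folklore] -/
theorem BState.pushL_eq (st : BState n) (w : W n) : st.pushL w = ⟨w :: st.lines, st.reps⟩ := by
  unfold BState.pushL; cases wlen w <;> rfl

/-- `pushR` leaves the lines unchanged. [folklore] -/
theorem BState.lines_pushR (st : BState n) (w : W n) : (st.pushR w).lines = st.lines := by
  unfold BState.pushR; cases wlen w <;> rfl

/-- The letter of code `b`: `2g ↦ x_g`, `2g+1 ↦ x_g⁻¹` (none if out of range). [folklore] -/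
def lett (n b : ℕ) : Option (Fin n × Bool) :=
  if h : b / 2 < n then some (⟨b / 2, h⟩, Nat.beq (Nat.land b 1) 0) else none

/-- The word pushed by a `rel a b` step. [folklore] -/
def wordRel (R : List (W n)) (a b : ℕ) : W n :=
  bif Nat.beq b 0 then nth R a else invW (nth R a)

/-- A relator or its inverse lies in `N P`. [folklore] -/
theorem mem_wordRel {P : ACCert.WPres n} {R : List (W n)} (hR : AllN P R) (a b : ℕ) :
    FreeGroup.mk (wordRel R a b) ∈ N P := by
  unfold wordRel
  cases Nat.beq b 0
  · show FreeGroup.mk (invW _) ∈ N P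
    rw [mk_invW]; exact (N P).inv_mem (hR.nth a)
  · exact hR.nth a

/-- Execute one decoded step `(op, a, b)`. (Havas–Ramsay 2003.) [cite: HavasRamsay2003] -/
def exec (R : List (W n)) (Lin Win : List (List (W n))) (st : BState n) (op a b : ℕ) :
    BState n :=
  bif Nat.beq op 4 then st.pushL (mulRed (sel st.lines Lin a) (sel st.lines Lin b))
  else bif Nat.beq op 5 then
    st.pushL (mulRed (mulRed (sel st.reps Win a) (sel st.lines Lin b)) (invW (sel st.reps Win a)))
  else bif Nat.beq op 3 then st.pushL (invW (sel st.lines Lin a))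
  else bif Nat.beq op 1 then
    st.pushR (match lett n b with
      | some ℓ => mulRed (sel st.reps Win a) [ℓ]
      | none => sel st.reps Win a)
  else bif Nat.beq op 2 then st.pushL (wordRel R a b)
  else st

/-- Execute the steps packed in `w` (at most `k` of them; `op = 0` ends the block). [folklore] -/
def runSteps (R : List (W n)) (Lin Win : List (List (W n))) : ℕ → BState n → ℕ → BState n
  | 0, st, _ => st
  | k + 1, st, w =>
      bif Nat.beq (Nat.land w 15) 0 then st
      else runSteps R Lin Win k
        (exec R Lin Win st (Nat.land w 15) (Nat.land (Nat.shiftRight w 4) 262143)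
          (Nat.land (Nat.shiftRight w 22) 262143))
        (Nat.shiftRight w 40)

/-- Steps per block. [folklore] -/
def blockLen : ℕ := 64

/-- RUN ONE BLOCK: the (lines, words) it produces, newest first. (Havas–Ramsay 2003.)
[cite: HavasRamsay2003] -/
def blk (R : List (W n)) (Lin Win : List (List (W n))) (prog : ℕ) : List (W n) × List (W n) :=
  let st := runSteps R Lin Win blockLen ⟨[], []⟩ prog
  (st.lines, st.reps)

/-! ### Soundness -/

/-- ONE STEP IS SOUND: `mul`, `conj`, `inv`, `rel` push words of `N P` (closure of the normal
subgroup `N P` under products, conjugation and inverses; `mk_mulRed`, `mk_invW`); `rep` and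
unknown opcodes do not touch the lines. (Havas–Ramsay 2003, §2.) [cite: HavasRamsay2003, §2] -/
theorem exec_sound {P : ACCert.WPres n} {R : List (W n)} {Lin Win : List (List (W n))}
    (hR : AllN P R) (hL : AllN2 P Lin) {st : BState n} (h : AllN P st.lines) (op a b : ℕ) :
    AllN P (exec R Lin Win st op a b).lines := by
  unfold exec
  cases Nat.beq op 4
  · cases Nat.beq op 5
    · cases Nat.beq op 3
      · cases Nat.beq op 1
        · cases Nat.beq op 2
          · exact h
          · show AllN P (st.pushL _).lines
            rw [BState.pushL_eq]; exact ⟨mem_wordRel hR a b, h⟩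
        · show AllN P (st.pushR _).lines
          rw [BState.lines_pushR]; exact h
      · show AllN P (st.pushL _).lines
        rw [BState.pushL_eq]
        refine ⟨?_, h⟩
        rw [mk_invW]
        exact (N P).inv_mem (sel_mem h hL a)
    · show AllN P (st.pushL _).lines
      rw [BState.pushL_eq]
      refine ⟨?_, h⟩
      rw [mk_mulRed, mk_mulRed, mk_invW]
      exact (Subgroup.normalClosure_normal (s := Set.range (ACCert.toPres P))).conj_mem _
        (sel_mem h hL b) _
  · show AllN P (st.pushL _).lines
    rw [BState.pushL_eq]
    refine ⟨?_, h⟩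
    rw [mk_mulRed]
    exact (N P).mul_mem (sel_mem h hL a) (sel_mem h hL b)

/-- Soundness of a run of steps (induction on the fuel). [folklore] -/
theorem runSteps_sound {P : ACCert.WPres n} {R : List (W n)} {Lin Win : List (List (W n))}
    (hR : AllN P R) (hL : AllN2 P Lin) : ∀ (k : ℕ) {st : BState n} (w : ℕ), AllN P st.lines →
    AllN P (runSteps R Lin Win k st w).lines
  | 0, _, _, h => h
  | k + 1, st, w, h => by
      unfold runSteps
      cases Nat.beq (Nat.land w 15) 0
      · exact runSteps_sound hR hL k _ (exec_sound hR hL h _ _ _)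
      · exact h

/-- BLOCK SOUNDNESS: if the relator table and the input lines lie in `N P`, so does every line the
block produces. (Havas–Ramsay 2003.) [cite: HavasRamsay2003] -/
theorem blk_sound {P : ACCert.WPres n} {R : List (W n)} {Lin : List (List (W n))} (hR : AllN P R)
    (hL : AllN2 P Lin) (Win : List (List (W n))) (prog : ℕ) : AllN P (blk R Lin Win prog).1 :=
  runSteps_sound hR hL blockLen prog (st := ⟨[], []⟩) trivial

/- The elaborator must never unfold the machine (it would re-evaluate earlier blocks while
type-checking the input lists of later ones); the kernel ignores these attributes. -/
attribute [irreducible] nth nthL blk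

/-- A CERTIFIED BLOCK: the block's output together with the proof that its lines lie in `N P`.
A certificate is a sequence of constants `Bₖ : SBlock P := mkBlock (relTable P) (allN_relTable P)
[input lines] ⟨their membership proofs⟩ [input words] 0x…` — one definition per block and no
separate theorem, so that neither the elaborator nor the kernel evaluates anything before the
final `decide`. [folklore] -/
structure SBlock (P : ACCert.WPres n) : Type where
  /-- (proof lines, conjugating words) produced by the block, newest first. -/
  val : List (W n) × List (W n)
  /-- Every proof line lies in the normal closure of the relators. -/
  sound : AllN P val.1

/-- Run and certify one block. (Havas–Ramsay 2003.) [cite: HavasRamsay2003] -/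
def mkBlock {P : ACCert.WPres n} (R : List (W n)) (hR : AllN P R) (Lin : List (List (W n)))
    (hLin : AllN2 P Lin) (Win : List (List (W n))) (prog : ℕ) : SBlock P :=
  ⟨blk R Lin Win prog, blk_sound hR hLin Win prog⟩

/-- THE FINAL CHECK: every block in the list is evaluated (this only bounds the depth of suspended
computations in the kernel) and `gens[i]` is the one-letter word `xᵢ` for every generator `i`.
[folklore] -/
def certify (blocks : List (List (W n) × List (W n))) (gens : List (W n)) : Bool :=
  (blocks.all fun b ↦ Nat.ble 0 (b.1.length + b.2.length)) &&
    ((List.finRange n).all fun i ↦ gens.getD i [] == [(i, true)])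

/-- CERTIFICATE THEOREM: if words known to lie in `N P` (`hg`, assembled from the block soundness
theorems) are literally the generators (`h`, a closed Boolean condition checked by `decide`), the
presentation presents the trivial group. (Havas–Ramsay 2000; 2003.) [cite: HavasRamsay2003] -/
theorem presentsTrivialGroup_of_certify (P : ACCert.WPres n)
    (blocks : List (List (W n) × List (W n))) (gens : List (W n)) (hg : AllN P gens)
    (h : certify blocks gens = true) : (ACCert.toPres P).PresentsTrivialGroup := by
  have h2 := ((Bool.and_eq_true_iff).1 h).2
  have hgen : ∀ i : Fin n, FreeGroup.of i ∈ N P := by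
    intro i
    have hi := List.all_eq_true.1 h2 i (List.mem_finRange i)
    have hget : gens.getD i [] = [(i, true)] := by simpa using hi
    have := hg.getD i
    rw [hget] at this
    exact this
  rw [BalancedPresentation.presentsTrivialGroup_iff_normalClosure_eq_top, eq_top_iff,
    ← FreeGroup.closure_range_of]
  exact (Subgroup.closure_le _).2 (Set.range_subset_iff.2 hgen)

/-- Variant stated against an arbitrary `BalancedPresentation` interpreted by `P`. [folklore] -/
theorem certifyPres {P : ACCert.WPres n} {P' : BalancedPresentation n} (hP : ACCert.toPres P = P')
    (blocks : List (List (W n) × List (W n))) (gens : List (W n)) (hg : AllN P gens)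
    (h : certify blocks gens = true) : P'.PresentsTrivialGroup :=
  hP ▸ presentsTrivialGroup_of_certify P blocks gens hg h

end NCCert

end Literature.Topology.FourManifolds
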